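import Mathlib.CategoryTheory.Galois.Full
import Mathlib.CategoryTheory.Galois.Prorepresentability
import Mathlib.CategoryTheory.Limits.FintypeCat
import Literature.AnabelianGeometry.SemiGraphs.GaloisCountableGraphs

/-!
# Splitting criterion: a finite étale covering splits over a connected `P` iff a stabiliser acts trivially

Mochizuki, *Semi-graphs of anabelioids*, Publ. RIMS **42** (2006), Def. 2.3 (iii) p. 25 ("splits")
and *Inter-universal Teichmüller theory I*, Rmk. 2.5.3 (i) (T2) p. 52 ("splits over the constituent
anabelioid") [cite: MochizukiSemiAnbd2006, Def. 2.3(iii) p.25]: in a connected anabelioid (Galois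
category) `C` with fibre functor `F`, an object `X` *splits over* a connected object `P`
(`SplitsOver X P`: `X × P ≅ ∐ P` over `P`, `GaloisCountableGraphs.lean`) as soon as the stabiliser in
`π₁ = Aut F` of a point of `F(P)` acts trivially on `F(X)` (`splitsOver_of_stabilizer`) — the usual
dictionary "the covering `X` becomes trivial over the covering `P`" ⟺ "`π₁(P) ≤ π₁(X)`-kernel".
Ingredients: morphisms `P → X` out of a connected object correspond to points of `F(X)` fixed by the
stabiliser (`exists_hom_of_stabilizer`, via the fullness of `C ⥤ Aut F-FinSets`), and an isomorphism is
detected on fibres.  Generic brick for the Galois-countability fact [IUTchI] Rmk. 2.5.3 (i) (T4) and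
for splitting arguments in [SemiAnbd] §§2–3.  Proof-only (no definitions).
-/

namespace Literature.AnabelianGeometry.SemiGraphs

open CategoryTheory CategoryTheory.Limits CategoryTheory.PreGaloisCategory

universe w u₂ u₁

variable {C : Type u₁} [Category.{u₂} C] [GaloisCategory C] (F : C ⥤ FintypeCat.{w}) [FiberFunctor F]

/-- A point of the fibre of a binary product is determined by its two projections.
[cite: MochizukiGeoAn2004, §1.1 p.9] -/
theorem fiber_prod_ext {X Y : C} (z z' : F.obj (X ⨯ Y)) (h₁ : F.map prod.fst z = F.map prod.fst z')
    (h₂ : F.map prod.snd z = F.map prod.snd z') : z = z' := by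
  have key : ∀ w : F.obj (X ⨯ Y),
      w = (fiberBinaryProductEquiv F X Y).symm (F.map prod.fst w, F.map prod.snd w) := by
    intro w
    obtain ⟨⟨a, b⟩, rfl⟩ := (fiberBinaryProductEquiv F X Y).symm.surjective w
    rw [fiberBinaryProductEquiv_symm_fst_apply, fiberBinaryProductEquiv_symm_snd_apply]
  rw [key z, key z', h₁, h₂]

/-- Morphisms out of a connected object: if the stabiliser in `Aut F` of `p₀ ∈ F(P)` fixes
`x ∈ F(X)`, there is a (unique) morphism `c : P → X` with `F(c)(p₀) = x` — the `Aut F`-equivariant map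
`σ p₀ ↦ σ x`, lifted along the full functor `C ⥤ Aut F-FinSets`. [cite: MochizukiGeoAn2004, §1.1 p.9] -/
theorem exists_hom_of_stabilizer {P X : C} [IsConnected P] (p₀ : F.obj P) (x : F.obj X)
    (h : ∀ σ : Aut F, σ • p₀ = p₀ → σ • x = x) : ∃ c : P ⟶ X, F.map c p₀ = x := by
  classical
  have htr : ∀ q : F.obj P, ∃ σ : Aut F, σ • p₀ = q := fun q => MulAction.exists_smul_eq (Aut F) p₀ q
  choose τ hτ using htr
  let f : F.obj P → F.obj X := fun q => τ q • x
  have hf : ∀ (ρ : Aut F) (q : F.obj P), f (ρ • q) = ρ • f q := by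
    intro ρ q
    change τ (ρ • q) • x = ρ • (τ q • x)
    have h1 : ((ρ * τ q)⁻¹ * τ (ρ • q)) • p₀ = p₀ := by
      rw [mul_smul, hτ, inv_smul_eq_iff, mul_smul, hτ]
    have h2 := h _ h1
    rw [mul_smul, inv_smul_eq_iff] at h2
    rw [h2, mul_smul]
  let g : (functorToAction F).obj P ⟶ (functorToAction F).obj X :=
    { hom := FintypeCat.homMk f
      comm := fun ρ => by
        ext q
        exact hf ρ q }
  refine ⟨(functorToAction F).preimage g, ?_⟩
  have hmap : F.map ((functorToAction F).preimage g) = FintypeCat.homMk f := by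
    have := (functorToAction F).map_preimage g
    exact congrArg Action.Hom.hom this
  rw [hmap, FintypeCat.homMk_apply]
  change τ p₀ • x = x
  exact h _ (hτ p₀)

/-- **Splitting criterion** ([SemiAnbd] Def. 2.3 (iii) "splits"; [IUTchI] Rmk. 2.5.3 (i) (T2)): if the
stabiliser in `π₁ = Aut F` of a point `p₀ ∈ F(P)` of a connected object `P` acts trivially on `F(X)`,
then `X` splits over `P`: `X × P ≅ ∐_{F(X)} P` over `P`, the copy indexed by `x` being the graph of the
morphism `P → X` through `x`. [cite: MochizukiSemiAnbd2006, Def. 2.3(iii) p.25] -/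
theorem splitsOver_of_stabilizer {X P : C} [IsConnected P] (p₀ : F.obj P)
    (h : ∀ σ : Aut F, σ • p₀ = p₀ → ∀ x : F.obj X, σ • x = x) : SplitsOver X P := by
  classical
  -- index the copies by `Fin n`, `n = |F(X)|`
  obtain ⟨n, ⟨ε⟩⟩ := Finite.exists_equiv_fin (F.obj X)
  have hc : ∀ i : Fin n, ∃ c : P ⟶ X, F.map c p₀ = ε.symm i :=
    fun i => exists_hom_of_stabilizer F p₀ (ε.symm i) (fun σ hσ => h σ hσ _)
  choose c hc using hc
  -- the comparison morphism `∐ P → X × P`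
  let u : (∐ fun _ : Fin n => P) ⟶ X ⨯ P := Sigma.desc fun i => prod.lift (c i) (𝟙 P)
  have hu_snd : u ≫ prod.snd = Sigma.desc fun _ => 𝟙 P := by
    apply Sigma.hom_ext
    intro i
    rw [Sigma.ι_desc_assoc, prod.lift_snd, Sigma.ι_desc]
  have hι_fst : ∀ (i : Fin n) (q : F.obj P),
      F.map prod.fst (F.map u (F.map (Sigma.ι (fun _ : Fin n => P) i) q)) = F.map (c i) q := by
    intro i q
    have e1 : Sigma.ι (fun _ : Fin n => P) i ≫ u ≫ prod.fst = c i := by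
      rw [Sigma.ι_desc_assoc, prod.lift_fst]
    have := congrArg (fun k => F.map k q) e1
    simpa only [Functor.map_comp, ConcreteCategory.comp_apply] using this
  have hι_snd : ∀ (i : Fin n) (q : F.obj P),
      F.map prod.snd (F.map u (F.map (Sigma.ι (fun _ : Fin n => P) i) q)) = q := by
    intro i q
    have e1 : Sigma.ι (fun _ : Fin n => P) i ≫ u ≫ prod.snd = 𝟙 P := by
      rw [Sigma.ι_desc_assoc, prod.lift_snd]
    have := congrArg (fun k => F.map k q) e1
    rw [F.map_id, FintypeCat.id_apply] at this
    simpa only [Functor.map_comp, ConcreteCategory.comp_apply] using this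
  -- every point of `F(∐ P)` comes from some summand
  have hjs : ∀ t : F.obj (∐ fun _ : Fin n => P), ∃ (i : Fin n) (q : F.obj P),
      F.map (Sigma.ι (fun _ : Fin n => P) i) q = t := by
    intro t
    have hcol := isColimitOfPreserves (F ⋙ forget FintypeCat)
      (coproductIsCoproduct (fun _ : Fin n => P))
    obtain ⟨⟨i⟩, q, hq⟩ := Types.jointly_surjective_of_isColimit hcol t
    exact ⟨i, q, hq⟩
  -- transitivity on `F(P)`
  have htr : ∀ q : F.obj P, ∃ σ : Aut F, σ • p₀ = q := fun q => MulAction.exists_smul_eq (Aut F) p₀ q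
  -- `F(u)` is bijective
  have hinj : Function.Injective (F.map u) := by
    intro t t' htt
    obtain ⟨i, q, rfl⟩ := hjs t
    obtain ⟨j, q', rfl⟩ := hjs t'
    have h2 : q = q' := by rw [← hι_snd i q, ← hι_snd j q', htt]
    subst h2
    have h1 : F.map (c i) q = F.map (c j) q := by rw [← hι_fst i q, ← hι_fst j q, htt]
    obtain ⟨σ, rfl⟩ := htr q
    rw [← mulAction_naturality, ← mulAction_naturality, hc, hc] at h1
    have hij : i = j := ε.symm.injective (smul_left_cancel σ h1)
    subst hij
    rfl
  have hsurj : Function.Surjective (F.map u) := by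
    intro z
    obtain ⟨σ, hσ⟩ := htr (F.map prod.snd z)
    let i : Fin n := ε (σ⁻¹ • F.map prod.fst z)
    refine ⟨F.map (Sigma.ι (fun _ : Fin n => P) i) (F.map prod.snd z), ?_⟩
    apply fiber_prod_ext F
    · rw [hι_fst, ← hσ, ← mulAction_naturality, hc]
      simp [i]
    · rw [hι_snd]
  haveI : IsIso (F.map u) := by
    have heq : F.map u = (FintypeCat.equivEquivIso (Equiv.ofBijective _ ⟨hinj, hsurj⟩)).hom := by
      ext t
      rfl
    rw [heq]
    infer_instance
  haveI : IsIso u := isIso_of_reflects_iso u F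
  refine ⟨n, (asIso u).symm, ?_⟩
  change inv u ≫ _ = _
  rw [IsIso.inv_comp_eq, hu_snd]

/-- **Converse of the splitting criterion**: if `X` splits over the connected object `P`, then the
stabiliser in `Aut F` of any point `p₀ ∈ F(P)` acts trivially on `F(X)` (the point `(x, p₀)` of
`X × P ≅ ∐ P` lies on a section `P → X × P` of the projection, along which `Aut F` acts through its
action on `p₀`). [cite: MochizukiSemiAnbd2006, Def. 2.3(iii) p.25] -/
theorem stabilizer_trivial_of_splitsOver {X P : C} (h : SplitsOver X P) (p₀ : F.obj P) (σ : Aut F)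
    (hσ : σ • p₀ = p₀) (x : F.obj X) : σ • x = x := by
  classical
  obtain ⟨n, e, he⟩ := h
  -- the sections `s_i : P → X × P`
  let s : Fin n → (P ⟶ X ⨯ P) := fun i => Sigma.ι (fun _ : Fin n => P) i ≫ e.inv
  have hs : ∀ i, s i ≫ prod.snd = 𝟙 P := by
    intro i
    have h1 : Sigma.desc (fun _ : Fin n => 𝟙 P) = e.inv ≫ prod.snd := by
      rw [← he, e.inv_hom_id_assoc]
    have := congrArg (fun k => Sigma.ι (fun _ : Fin n => P) i ≫ k) h1
    simp only [Sigma.ι_desc] at this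
    rw [Category.assoc]
    exact this.symm
  -- the point `(x, p₀)` lies on some section
  let z : F.obj (X ⨯ P) := (fiberBinaryProductEquiv F X P).symm (x, p₀)
  have hjs : ∃ (i : Fin n) (q : F.obj P), F.map (Sigma.ι (fun _ : Fin n => P) i) q = F.map e.hom z := by
    have hcol := isColimitOfPreserves (F ⋙ forget FintypeCat)
      (coproductIsCoproduct (fun _ : Fin n => P))
    obtain ⟨⟨i⟩, q, hq⟩ := Types.jointly_surjective_of_isColimit hcol (F.map e.hom z)
    exact ⟨i, q, hq⟩
  obtain ⟨i, q, hq⟩ := hjs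
  have hz : F.map (s i) q = z := by
    change F.map (Sigma.ι (fun _ : Fin n => P) i ≫ e.inv) q = z
    rw [F.map_comp, FintypeCat.comp_apply, hq, ← FintypeCat.comp_apply, ← F.map_comp,
      e.hom_inv_id, F.map_id, FintypeCat.id_apply]
  have hqp : q = p₀ := by
    have := congrArg (fun k => F.map k q) (hs i)
    rw [F.map_id, FintypeCat.id_apply] at this
    simp only [Functor.map_comp, FintypeCat.comp_apply] at this
    rw [hz] at this
    rw [← this]
    exact fiberBinaryProductEquiv_symm_snd_apply F x p₀
  subst hqp
  -- `σ` fixes `z`, hence `x`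
  have hσz : σ • z = z := by
    rw [← hz, mulAction_naturality, hσ]
  have hx : F.map prod.fst z = x := fiberBinaryProductEquiv_symm_fst_apply F x q
  rw [← hx, mulAction_naturality, hσz]

/-- **Splitting criterion, both directions**: for a connected `P` with a point `p₀ ∈ F(P)`, `X` splits
over `P` iff the stabiliser of `p₀` in `π₁ = Aut F` acts trivially on `F(X)`.
[cite: MochizukiSemiAnbd2006, Def. 2.3(iii) p.25] -/
theorem splitsOver_iff_stabilizer {X P : C} [IsConnected P] (p₀ : F.obj P) :
    SplitsOver X P ↔ ∀ σ : Aut F, σ • p₀ = p₀ → ∀ x : F.obj X, σ • x = x :=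
  ⟨fun h σ hσ x => stabilizer_trivial_of_splitsOver F h p₀ σ hσ x,
    fun h => splitsOver_of_stabilizer F p₀ h⟩

end Literature.AnabelianGeometry.SemiGraphs
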